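import Literature.Geometry.Lorentzian.KerrRedShiftEstimatePolyPrelims
import Literature.Geometry.Lorentzian.KerrRedShiftCoercivityPoly
import HarnessLib

/-!
# The red-shift estimate between admissible graph leaves with κ-EXPLICIT constants, I: the weighted
# estimate at fixed receding parameter (DRSR Prop. 4.5.2, κ-tracked)
(namespace `Literature.Geometry.Lorentzian.Kerr`.)

`Kerr.redShift_weighted_estimate` (`KerrRedShiftEstimate.lean`) proves DRSR Prop. 4.5.2 at fixed receding
parameter with `∃ η₀(M, a)` and `∃ A, C` chosen after `a` by compactness. This file re-runs the SAME
proof with the explicit inputs of `KerrRedShiftCoercivityPoly.lean` (coercivity `κ/4000` on the collar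
`r₊ ≤ r ≤ r₊ + M²κ/4096` for `h₁ = f₁ = 512/(M²κ)`), `KerrRedShiftTimelikePoly.lean` (timelike,
transversal), `KerrRedShiftEstimatePolyPrelims.lean` (`|N^μ| ≤ 4`) and the uniform background bound
`Kerr.abs_fderiv_surgeryBackground_rPlus_le` (`D = (4640 + 80C_σ)/M`):

* `Kerr.redShift_weighted_estimate_poly` — for `|a| < M`, a bound `C_σ` of `|σ'|` and every width
  `0 < η ≤ M²κ/4096` there are `A`, `C` with `1/(6 + (48000(160D + 1) + 8000)/κ) ≤ A`, `C ≤ 1200`, and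
  the weighted estimate of `Kerr.redShift_weighted_estimate` (same statement, same proof).
The constant `A⁻¹` is thus LINEAR in `κ⁻¹` and the width is LINEAR in `κ`.

## References
* M. Dafermos, I. Rodnianski, Y. Shlapentokh-Rothman, arXiv:1402.7034, §2.3.2, Prop. 4.5.2, §13.2
  (key `DafermosRodnianskiShlapentokhrothman2014`).
* M. Dafermos, I. Rodnianski, arXiv:0811.0354, §3.3.3, Thm. 7.1 (key `DafermosRodnianski2008`).
-/

noncomputable section

open Set Filter Metric MeasureTheory
open scoped Topology ENNReal

namespace Literature.Geometry.Lorentzian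

namespace Kerr

variable {M a : ℝ} {x : E4}

/-- The lower bound for the constant `A = min(ε₀/6, b₁/2)`, `ε₀ = min 1 (b₁/(2(32(1 + B)D + 1)))`,
`b₁ = κ/4000` of the weighted red-shift estimate: `1/(6 + (48000(160D + 1) + 8000)/κ) ≤ A` for
`0 ≤ B ≤ 4`, `0 ≤ D`, `0 < κ`. [folklore] -/
theorem redShift_polyA_lower {B D κ : ℝ} (hκ : 0 < κ) (hB0 : 0 ≤ B) (hB4 : B ≤ 4) (hD0 : 0 ≤ D) :
    1 / (6 + (48000 * (160 * D + 1) + 8000) / κ) ≤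
      min (min 1 (κ / 4000 / (2 * (32 * (1 + B) * D + 1))) / 6) (κ / 4000 / 2) := by
  have hY0 : 0 < 2 * (32 * (1 + B) * D + 1) := by positivity
  have hYle : 2 * (32 * (1 + B) * D + 1) ≤ 2 * (160 * D + 1) := by nlinarith only [hB4, hD0, hB0]
  have hden : 0 < 6 + (48000 * (160 * D + 1) + 8000) / κ := by positivity
  have hP0 : 0 ≤ 48000 * (160 * D + 1) / κ := by positivity
  have hQ0 : 0 ≤ 8000 / κ := by positivity
  have hsplit : (48000 * (160 * D + 1) + 8000) / κ = 48000 * (160 * D + 1) / κ + 8000 / κ := add_div _ _ _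
  rw [div_le_iff₀ hden, min_mul_of_nonneg _ _ hden.le]
  apply le_min
  · rcases le_total 1 (κ / 4000 / (2 * (32 * (1 + B) * D + 1))) with h1 | h1
    · rw [min_eq_left h1]; linarith only [hP0, hQ0, hsplit]
    · rw [min_eq_right h1]
      have h2 : 1 ≤ κ / 4000 / (2 * (32 * (1 + B) * D + 1)) / 6 * (48000 * (160 * D + 1) / κ) := by
        rw [show κ / 4000 / (2 * (32 * (1 + B) * D + 1)) / 6 * (48000 * (160 * D + 1) / κ) =
            2 * (160 * D + 1) / (2 * (32 * (1 + B) * D + 1)) by field_simp; ring]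
        rwa [one_le_div hY0]
      have h3 : 0 ≤ κ / 4000 / (2 * (32 * (1 + B) * D + 1)) / 6 := by positivity
      have h4 := mul_le_mul_of_nonneg_left (show 48000 * (160 * D + 1) / κ ≤
        6 + (48000 * (160 * D + 1) + 8000) / κ by linarith only [hQ0, hsplit]) h3
      linarith only [h2, h4]
  · have h2 : κ / 4000 / 2 * (8000 / κ) = 1 := by field_simp; ring
    have h4 := mul_le_mul_of_nonneg_left (show 8000 / κ ≤ 6 + (48000 * (160 * D + 1) + 8000) / κ by
      linarith only [hP0, hsplit]) (by positivity : (0 : ℝ) ≤ κ / 4000 / 2)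
    linarith only [h2, h4]

set_option maxHeartbeats 400000 in
/-- **The red-shift estimate between admissible graph leaves at fixed receding parameter, with
κ-explicit constants** (DRSR Prop. 4.5.2 in the form of the first display of §13.2, before `ε → 0`).
For sub-extremal `(M, a)`, `κ = Kerr.surfaceGravity M a`, a bound `C_σ` for `|σ'|`
(`σ = Real.smoothTransition`) and a collar width `0 < η ≤ M²κ/4096` there are `A`, `C` with
`1/(6 + (48000(160D + 1) + 8000)/κ) ≤ A` (`D = (4640 + 80C_σ)/M`) and `0 ≤ C ≤ 1200` such that for every
`C²` height `F` of slope `∑(∂_iF)² ≤ (1 − c)²` (`0 < c ≤ 1`), every `Φ` of class `C²` on the exterior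
solving the wave equation of the surgered background there, every `ε > 0` and every `s ≥ 0`, with
`W_ε = χσ(u₂/ε − 1)` the weight for the radii `R₁ = r₊ + η/2 < R₂ = r₊ + η` and the red-shift multiplier
`N` with `h₁ = f₁ = 512/(M²κ)`:
`A c ∫_{Σ̃_s} W_ε ∑(∂Φ)² + A ∫_0^s∫_{Σ̃_u} W_ε ∑(∂Φ)² ≤ C ∫_{Σ̃_0} W_ε ∑(∂Φ)² + C ∫_0^s∫_{Σ̃_u} (∑_μ|∂_μχ|) ∑(∂Φ)²`.
Proof: verbatim `Kerr.redShift_weighted_estimate` with the explicit collar data.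
[cite: DafermosRodnianskiShlapentokhrothman2014, Prop. 4.5.2 and §13.2] -/
theorem redShift_weighted_estimate_poly (hMa : IsSubextremal M a) {Cσ : ℝ}
    (hCσ : ∀ t, |deriv Real.smoothTransition t| ≤ Cσ) {η : ℝ} (hη : 0 < η)
    (hηle : η ≤ M ^ 2 * surfaceGravity M a / 4096) :
    ∃ A C : ℝ, 0 < A ∧
      1 / (6 + (48000 * (160 * ((4640 + 80 * Cσ) / M) + 1) + 8000) / surfaceGravity M a) ≤ A ∧
      0 ≤ C ∧ C ≤ 1200 ∧
      ∀ (F : E3 → ℝ) (c : ℝ), ContDiff ℝ 2 F → 0 < c → c ≤ 1 →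
      (∀ y, ∑ i, partialE3 F y i ^ 2 ≤ (1 - c) ^ 2) →
      ∀ Φ : E4 → ℝ, (∀ x ∈ (exterior M a : Set E4), ContDiffAt ℝ 2 Φ x) →
      (∀ x ∈ (exterior M a : Set E4), KerrSchild.waveOperator
          (surgeryBackground M a (rPlus M a) hMa.pos.le hMa.rPlus_pos).inverseMetric Φ x = 0) →
      ∀ ε : ℝ, 0 < ε → ∀ s : ℝ, 0 ≤ s →
        A * c * (∫ y in closedBall (0 : E3) √((rPlus M a + η) ^ 2 + a ^ 2),
            redShiftWeight M a (rPlus M a + η / 2) (rPlus M a + η) ε (E4.ofTimeSpace (s + F y) y) *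
              ∑ μ, fderiv ℝ Φ (E4.ofTimeSpace (s + F y) y) (E4.basisVector μ) ^ 2) +
          A * ∫ u in Set.Ioc 0 s, ∫ y in closedBall (0 : E3) √((rPlus M a + η) ^ 2 + a ^ 2),
            redShiftWeight M a (rPlus M a + η / 2) (rPlus M a + η) ε (E4.ofTimeSpace (u + F y) y) *
              ∑ μ, fderiv ℝ Φ (E4.ofTimeSpace (u + F y) y) (E4.basisVector μ) ^ 2 ≤
        C * (∫ y in closedBall (0 : E3) √((rPlus M a + η) ^ 2 + a ^ 2),
            redShiftWeight M a (rPlus M a + η / 2) (rPlus M a + η) ε (E4.ofTimeSpace (0 + F y) y) *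
              ∑ μ, fderiv ℝ Φ (E4.ofTimeSpace (0 + F y) y) (E4.basisVector μ) ^ 2) +
          C * ∫ u in Set.Ioc 0 s, ∫ y in closedBall (0 : E3) √((rPlus M a + η) ^ 2 + a ^ 2),
            (∑ μ, |fderiv ℝ (collarCutoff a (rPlus M a + η / 2) (rPlus M a + η))
                (E4.ofTimeSpace (u + F y) y) (E4.basisVector μ)|) *
              ∑ μ, fderiv ℝ Φ (E4.ofTimeSpace (u + F y) y) (E4.basisVector μ) ^ 2 := by
  -- ### constants of the background (κ-explicit)
  have hM : 0 < M := hMa.pos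
  have hMa' : |a| ≤ M := le_of_lt hMa
  have hrp : 0 < rPlus M a := hMa.rPlus_pos
  have hκ : 0 < surfaceGravity M a := hMa.surfaceGravity_pos
  have hC0σ : 0 ≤ Cσ := (abs_nonneg _).trans (hCσ 0)
  have hMκ : M * surfaceGravity M a ≤ 1 / 4 := by
    have h := surfaceGravity_le hM a
    rw [le_div_iff₀ (by positivity : (0 : ℝ) < 4 * M)] at h; linarith only [h]
  have hηM : η ≤ M / 16384 := by
    have : M ^ 2 * surfaceGravity M a / 4096 ≤ M / 16384 := by
      rw [div_le_div_iff₀ (by norm_num) (by norm_num)]; nlinarith only [hMκ, hM]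
    exact hηle.trans this
  set hp : ℝ := 512 / (M ^ 2 * surfaceGravity M a) with hhp
  have hp0 : 0 < hp := by positivity
  have hpη : hp * η ≤ 1 := by
    have h0 : 0 ≤ M ^ 2 * surfaceGravity M a := by positivity
    rw [hhp, div_mul_eq_mul_div, div_le_one (by positivity)]; linarith only [hηle, h0]
  -- the collars of `N` (explicit: `KerrRedShiftCoercivityPoly`, `KerrRedShiftTimelikePoly`)
  set b₁ : ℝ := surfaceGravity M a / 4000 with hb₁_def
  have hb₁ : 0 < b₁ := by positivity
  have hcoer : ∀ x : E4, rPlus M a ≤ radius a x → radius a x ≤ rPlus M a + η →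
      ∀ w : E4 → ℝ, b₁ * ∑ μ, fderiv ℝ w x (E4.basisVector μ) ^ 2 ≤
        KerrSchild.multiplierBulk (inverseMetric M a) (redShiftVector M a hp hp) w x :=
    fun x h1 h2 w ↦ redShift_bulk_coercive_poly hMa h1 (h2.trans (by linarith)) w
  have hcol : ∀ x : E4, rPlus M a ≤ radius a x → radius a x ≤ rPlus M a + η →
      bilin M a x (redShiftVec M a hp hp x) (redShiftVec M a hp hp x) ≤ -2⁻¹ ∧
        1 ≤ redShiftVec M a hp hp x 0 ∧
        ∀ n ∈ admissibleConormals, 4⁻¹ ≤ ∑ μ, n μ * redShiftVec M a hp hp x μ :=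
    fun x h1 h2 ↦ redShift_timelike_collar_poly hMa hp0.le h1 (h2.trans (by linarith))
      ((mul_le_mul_of_nonneg_left (by linarith) hp0.le).trans hpη)
  -- the surgered background and its bounds (uniform: `abs_fderiv_surgeryBackground_rPlus_le`)
  set B := surgeryBackground M a (rPlus M a) hMa.pos.le hMa.rPlus_pos with hB
  have hΦb0 : 0 ≤ B.bound := (B.φ_nonneg 0).trans (B.φ_le 0)
  have hΦb4 : B.bound ≤ 4 := by
    show 4 * M / rPlus M a ≤ 4
    rw [div_le_iff₀ hrp]
    linarith [rPlus_sub_self M a, Real.sqrt_nonneg (M ^ 2 - a ^ 2)]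
  set D : ℝ := (4640 + 80 * Cσ) / M with hD_def
  have hD0 : 0 ≤ D := by positivity
  have hD : ∀ (x : E4) (μ α β : Fin 4),
      |fderiv ℝ (fun z ↦ B.inverseMetric z α β) x (E4.basisVector μ)| ≤ D :=
    fun x μ α β ↦ abs_fderiv_surgeryBackground_rPlus_le hMa hCσ x μ α β
  obtain ⟨Ξ, hΞ_def⟩ : ∃ Ξ : ℝ, Ξ = 4 := ⟨4, rfl⟩
  have hΞ0 : (0 : ℝ) ≤ Ξ := by rw [hΞ_def]; norm_num
  have hΞ : ∀ x : E4, rPlus M a ≤ radius a x → radius a x ≤ rPlus M a + η →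
      ∀ α, |redShiftVector M a hp hp x α| ≤ Ξ :=
    fun x h1 h2 α ↦ hΞ_def ▸ abs_redShiftVector_le_four hMa' hM hp0.le h1 (h2.trans (by linarith))
      ((mul_le_mul_of_nonneg_left (by linarith) hp0.le).trans hpη) α
  -- radii and the cut-off bound
  set R₁ : ℝ := rPlus M a + η / 2 with hR₁
  set R₂ : ℝ := rPlus M a + η with hR₂
  have hR₁pos : 0 < R₁ := by positivity
  have hR12 : R₁ < R₂ := by rw [hR₁, hR₂]; linarith
  have hrR₁ : rPlus M a < R₁ := by rw [hR₁]; linarith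
  obtain ⟨L, hL0, hL⟩ := exists_abs_fderiv_collarCutoff_le (a := a) hR₁pos hR12
  -- the constants
  set CJ : ℝ := 6 * (1 + B.bound) * Ξ + 6 * (1 + B.bound) ^ 2 with hCJ
  have hCJ0 : 0 ≤ CJ := by positivity
  set ε₀ : ℝ := min 1 (b₁ / (2 * (32 * (1 + B.bound) * D + 1))) with hε₀
  have hε₀pos : 0 < ε₀ := lt_min one_pos (by positivity)
  have hε₀le1 : ε₀ ≤ 1 := min_le_left _ _
  have hε₀D : ε₀ * (32 * (1 + B.bound) * D) ≤ b₁ / 2 := by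
    have h1 : ε₀ ≤ b₁ / (2 * (32 * (1 + B.bound) * D + 1)) := min_le_right _ _
    have h2 : 0 ≤ 32 * (1 + B.bound) * D := by positivity
    calc ε₀ * (32 * (1 + B.bound) * D)
        ≤ b₁ / (2 * (32 * (1 + B.bound) * D + 1)) * (32 * (1 + B.bound) * D + 1) :=
          mul_le_mul h1 (by linarith) h2 (by positivity)
      _ = b₁ / 2 := by field_simp
  set A : ℝ := min (ε₀ / 6) (b₁ / 2) with hA
  have hApos : 0 < A := lt_min (by positivity) (by positivity)
  have hAε : A ≤ ε₀ / 6 := min_le_left _ _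
  have hAb : A ≤ b₁ / 2 := min_le_right _ _
  -- the explicit bounds on `A` and `C = 4CJ`
  have hCJle : 4 * CJ ≤ 1200 := by
    rw [hCJ, hΞ_def]; nlinarith only [hΦb0, hΦb4]
  have hAlow : 1 / (6 + (48000 * (160 * D + 1) + 8000) / surfaceGravity M a) ≤ A :=
    redShift_polyA_lower hκ hΦb0 hΦb4 hD0
  refine ⟨A, 4 * CJ, hApos, hAlow, by positivity, hCJle, fun F c hF hc hc1 hFc Φ hΦ hsol ε hε s hs ↦ ?_⟩
  -- ### notation
  set ρ : ℝ := √(R₂ ^ 2 + a ^ 2) with hρ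
  set G := B.inverseMetric with hG
  set N : E4 → Fin 4 → ℝ := redShiftVector M a hp hp with hN
  set χ : E4 → ℝ := collarCutoff a R₁ R₂ with hχ
  set hf : E4 → ℝ := fun y ↦ Real.smoothTransition (horizonFn M a y / ε - 1) with hhf
  set W : E4 → ℝ := redShiftWeight M a R₁ R₂ ε with hW
  set K : Set E4 := redShiftWeightSet M a R₂ ε with hK
  set U : Set E4 := (exterior M a : Set E4) with hU
  set p2 : E4 → ℝ := fun x ↦ ∑ μ, fderiv ℝ Φ x (E4.basisVector μ) ^ 2 with hp2
  set JN : Fin 4 → E4 → ℝ := fun μ x ↦ KerrSchild.multiplierCurrent G N Φ x μ with hJN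
  set P : Fin 4 → E4 → ℝ := fun μ x ↦ KerrSchild.normalCurrent G Φ x μ with hP
  set Cur : Fin 4 → E4 → ℝ := fun μ x ↦ -JN μ x + ε₀ * P μ x with hCur
  set J : Fin 4 → E4 → ℝ := fun μ x ↦ W x * Cur μ x with hJ
  set n : E4 → Fin 4 → ℝ := fun x μ ↦ graphConormal F (E4.spatial x) μ with hn
  set V : E4 → ℝ := fun x ↦ ∑ μ, |fderiv ℝ χ x (E4.basisVector μ)| with hV
  set ℓ : E4 → ℝ := fun x ↦ b₁ / 2 * (W x * p2 x) with hℓ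
  set e : E4 → ℝ := fun x ↦ 4 * CJ * (V x * p2 x) with he
  have hp2nn : ∀ x, 0 ≤ p2 x := fun x ↦ Finset.sum_nonneg fun μ _ ↦ sq_nonneg _
  -- ### the weight and its support
  have hWdef : ∀ x, W x = χ x * hf x := fun x ↦ rfl
  have hKc : IsClosed K := isClosed_redShiftWeightSet M a R₂ ε
  have hKU : K ⊆ U := redShiftWeightSet_subset_exterior hrp hε
  have hWK : ∀ x, W x ≠ 0 → x ∈ K := fun x hx ↦ mem_redShiftWeightSet_of_ne_zero hR12 hε hx
  have hWz : ∀ x, x ∉ K → W x = 0 := fun x hx ↦ by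
    by_contra h
    exact hx (hWK x h)
  have hW1 : ContDiff ℝ 1 W := contDiff_redShiftWeight hR₁pos hR12 hrp hε
  have hW0 : ∀ x, 0 ≤ W x := redShiftWeight_nonneg M a R₁ R₂ ε
  have hWle : ∀ x, W x ≤ 1 := redShiftWeight_le_one M a R₁ R₂ ε
  have hχ1 : ContDiff ℝ 1 χ := contDiff_collarCutoff hR₁pos hR12
  have hhf1 : ContDiff ℝ 1 hf := contDiff_horizonFactor hrp hε
  have hχ0 : ∀ x, 0 ≤ χ x := collarCutoff_nonneg a R₁ R₂
  have hhf0 : ∀ x, 0 ≤ hf x := fun x ↦ Real.smoothTransition.nonneg _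
  have hhfle : ∀ x, hf x ≤ 1 := fun x ↦ Real.smoothTransition.le_one _
  have hV0 : ∀ x, 0 ≤ V x := fun x ↦ Finset.sum_nonneg fun μ _ ↦ abs_nonneg _
  -- geometry of the points of `K`
  have hKr : ∀ x ∈ K, rPlus M a < radius a x := fun x hx ↦
    rPlus_lt_radius_of_mem_redShiftWeightSet hε hx
  have hKR₂ : ∀ x ∈ K, radius a x ≤ rPlus M a + η := fun x hx ↦ hx.2
  have hKabs : ∀ x ∈ K, |radius a x - rPlus M a| ≤ η := fun x hx ↦ by
    rw [abs_of_pos (sub_pos.mpr (hKr x hx))]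
    linarith [hKR₂ x hx]
  have hUpos : ∀ x ∈ U, 0 < radius a x := fun x hx ↦ radius_pos_of_mem_region hx
  have hUr : ∀ x ∈ U, rPlus M a < radius a x := fun x hx ↦ lt_radius_of_mem_region hx
  -- ### regularity of the densities and currents at exterior points
  have hpν : ∀ x ∈ U, ∀ ν, ContinuousAt (fun y ↦ fderiv ℝ Φ y (E4.basisVector ν)) x := by
    intro x hx ν
    have h2 : ContDiffAt ℝ ((1 : ℕ∞) + 1 : ℕ∞) Φ x := by exact_mod_cast hΦ x hx
    exact ((h2.fderiv_right (m := 1) le_rfl).clm_apply contDiffAt_const).continuousAt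
  have hp2c : ∀ x ∈ U, ContinuousAt p2 x := fun x hx ↦
    tendsto_finsetSum _ fun ν _ ↦ (hpν x hx ν).pow 2
  have hP1 : ∀ μ, ∀ x ∈ U, ContDiffAt ℝ 1 (P μ) x := fun μ x hx ↦
    B.contDiffAt_normalCurrent (hΦ x hx) μ
  have hJN1 : ∀ μ, ∀ x ∈ U, ContDiffAt ℝ 1 (JN μ) x := fun μ x hx ↦
    contDiffAt_redShiftCurrent hMa hp hp (hΦ x hx) (hUpos x hx) μ
  have hCur1 : ∀ μ, ∀ x ∈ U, ContDiffAt ℝ 1 (Cur μ) x := fun μ x hx ↦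
    (hJN1 μ x hx).neg.add (contDiffAt_const.mul (hP1 μ x hx))
  have hJ1 : ∀ μ, ContDiff ℝ 1 (J μ) := fun μ ↦
    contDiff_iff_contDiffAt.mpr fun x ↦ contDiffAt_weight_mul hKc hKU hW1 hWK (hCur1 μ) x
  have hJ0 : ∀ μ x, x ∉ K → J μ x = 0 := fun μ x hx ↦ by
    simp only [hJ, hWz x hx, zero_mul]
  -- continuity of `ℓ` and `e` on `ℝ⁴`
  have hℓc : Continuous ℓ :=
    continuous_const.mul (continuous_iff_continuousAt.mpr fun x ↦
      continuousAt_weight_mul hKc hKU hW1.continuous hWz hp2c x)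
  have hℓK : ∀ x, x ∉ K → ℓ x = 0 := fun x hx ↦ by
    simp only [hℓ, hWz x hx, zero_mul, mul_zero]
  set Ksh : Set E4 := {x | R₁ ≤ radius a x ∧ radius a x ≤ R₂} with hKsh
  have hKshc : IsClosed Ksh := by
    rw [hKsh, Set.setOf_and]
    exact (isClosed_le continuous_const (continuous_radius a)).inter
      (isClosed_le (continuous_radius a) continuous_const)
  have hKshU : Ksh ⊆ U := fun x hx ↦
    mem_exterior.2 (max_lt (hrR₁.trans_le hx.1) (hrp.trans (hrR₁.trans_le hx.1)))
  have hVc : Continuous V :=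
    continuous_finsetSum _ fun μ _ ↦
      ((hχ1.continuous_fderiv one_ne_zero).clm_apply continuous_const).abs
  have hVz : ∀ x, x ∉ Ksh → V x = 0 := by
    intro x hx
    refine Finset.sum_eq_zero fun μ _ ↦ ?_
    by_contra hne
    exact hx ((hL x μ).2 (fun h0 ↦ hne (by rw [h0, abs_zero])))
  have hec : Continuous e :=
    continuous_const.mul (continuous_iff_continuousAt.mpr fun x ↦
      continuousAt_weight_mul hKshc hKshU hVc hVz hp2c x)
  have he0 : ∀ x, 0 ≤ e x := fun x ↦ mul_nonneg (by positivity) (mul_nonneg (hV0 x) (hp2nn x))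
  -- spatial bound on `K`
  have hρK : ∀ x ∈ K, F (E4.spatial x) ≤ x 0 → x 0 ≤ s + F (E4.spatial x) →
      E4.spatialNorm x ≤ ρ := fun x hx _ _ ↦
    spatialNorm_le_of_mem_redShiftWeightSet hrp hε hx
  -- ### pointwise bounds on the currents at the points of `K`
  have hΞK : ∀ x ∈ K, ∀ α, |N x α| ≤ Ξ := fun x hx α ↦ hΞ x (hKr x hx).le (hKR₂ x hx) α
  have hCurK : ∀ x ∈ K, ∀ μ, |Cur μ x| ≤ CJ * p2 x := by
    intro x hx μ
    have h1 : |JN μ x| ≤ 6 * (1 + B.bound) * Ξ * p2 x :=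
      B.abs_multiplierCurrent_le Φ x (hΞK x hx) μ
    have h2 : |P μ x| ≤ 6 * (1 + B.bound) ^ 2 * p2 x := B.abs_normalCurrent_le Φ x μ
    have h3 : |ε₀ * P μ x| ≤ 6 * (1 + B.bound) ^ 2 * p2 x := by
      rw [abs_mul, abs_of_pos hε₀pos]
      calc ε₀ * |P μ x| ≤ 1 * |P μ x| := mul_le_mul_of_nonneg_right hε₀le1 (abs_nonneg _)
        _ ≤ 6 * (1 + B.bound) ^ 2 * p2 x := by rw [one_mul]; exact h2
    calc |Cur μ x| = |-JN μ x + ε₀ * P μ x| := rfl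
      _ ≤ |-JN μ x| + |ε₀ * P μ x| := abs_add_le _ _
      _ ≤ 6 * (1 + B.bound) * Ξ * p2 x + 6 * (1 + B.bound) ^ 2 * p2 x := by
          rw [abs_neg]; exact add_le_add h1 h3
      _ = CJ * p2 x := by rw [hCJ]; ring
  -- collar facts at the points of `K`
  have hcolK : ∀ x ∈ K,
      bilin M a x (redShiftVec M a hp hp x) (redShiftVec M a hp hp x) < 0 ∧
        0 ≤ redShiftVec M a hp hp x 0 ∧
        ∀ n' ∈ admissibleConormals, 0 < ∑ μ, n' μ * N x μ := by
    intro x hx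
    obtain ⟨h1, h2, h3⟩ := hcol x (hKr x hx).le (hKR₂ x hx)
    refine ⟨by linarith, by linarith, fun n' hn' ↦ ?_⟩
    have h4 := h3 n' hn'
    simp only [redShiftVec_apply] at h4
    linarith
  have hnadm : ∀ x, n x ∈ admissibleConormals := fun x ↦
    graphConormal_mem_admissibleConormals ((hFc (E4.spatial x)).trans (by nlinarith))
  -- ### the leaf flux: lower and upper bounds
  have hfluxW : ∀ x, ∑ μ, J μ x * n x μ = W x * ∑ μ, Cur μ x * n x μ := by
    intro x
    simp only [hJ, Finset.mul_sum]
    exact Finset.sum_congr rfl fun μ _ ↦ by ring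
  have hqlow : ∀ x, A * c * (W x * p2 x) ≤ ∑ μ, J μ x * n x μ := by
    intro x
    rw [hfluxW x]
    by_cases hWx : W x = 0
    · simp only [hWx, zero_mul, mul_zero, le_refl]
    have hxK : x ∈ K := hWK x hWx
    have hxr := hKr x hxK
    obtain ⟨hNN, -, hco⟩ := hcolK x hxK
    have h1 : 0 ≤ -∑ μ, JN μ x * n x μ :=
      neg_sum_redShiftCurrent_mul_nonneg hMa hxr hNN (hnadm x) (hco _ (hnadm x)) Φ
    have h2 : c * P 0 x ≤ ∑ μ, n x μ * P μ x :=
      B.mul_normalCurrent_zero_le_graphFlux Φ x hc hc1 (hFc (E4.spatial x))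
    have h3 : p2 x ≤ 6 * P 0 x := B.sum_sq_le_six_mul_normalCurrent_zero Φ x
    have hsplit : ∑ μ, Cur μ x * n x μ = -∑ μ, JN μ x * n x μ + ε₀ * ∑ μ, n x μ * P μ x := by
      simp only [hCur, Finset.mul_sum, ← Finset.sum_neg_distrib, ← Finset.sum_add_distrib]
      exact Finset.sum_congr rfl fun μ _ ↦ by ring
    rw [hsplit]
    have h4 : A * c * p2 x ≤ ε₀ * (c * P 0 x) := by
      calc A * c * p2 x ≤ ε₀ / 6 * c * (6 * P 0 x) := by gcongr
        _ = ε₀ * (c * P 0 x) := by ring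
    have h5 : ε₀ * (c * P 0 x) ≤ ε₀ * ∑ μ, n x μ * P μ x := mul_le_mul_of_nonneg_left h2 hε₀pos.le
    have hWx0 : 0 ≤ W x := hW0 x
    calc A * c * (W x * p2 x) = W x * (A * c * p2 x) := by ring
      _ ≤ W x * (-∑ μ, JN μ x * n x μ + ε₀ * ∑ μ, n x μ * P μ x) :=
          mul_le_mul_of_nonneg_left (by linarith) hWx0
  have hqup : ∀ x, ∑ μ, J μ x * n x μ ≤ 4 * CJ * (W x * p2 x) := by
    intro x
    rw [hfluxW x]
    by_cases hWx : W x = 0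
    · simp only [hWx, zero_mul, mul_zero, le_refl]
    have hxK : x ∈ K := hWK x hWx
    have h1 : ∑ μ, Cur μ x * n x μ ≤ ∑ _μ : Fin 4, CJ * p2 x := by
      refine Finset.sum_le_sum fun μ _ ↦ ?_
      have ha := abs_apply_le_one_of_mem_admissibleConormals (hnadm x) μ
      have hb := hCurK x hxK μ
      calc Cur μ x * n x μ ≤ |Cur μ x * n x μ| := le_abs_self _
        _ = |Cur μ x| * |n x μ| := abs_mul _ _
        _ ≤ CJ * p2 x * 1 := mul_le_mul hb ha (abs_nonneg _) (by positivity)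
        _ = CJ * p2 x := mul_one _
    have h2 : ∑ _μ : Fin 4, CJ * p2 x = 4 * (CJ * p2 x) := by
      simp only [Finset.sum_const, Finset.card_univ, Fintype.card_fin, nsmul_eq_mul, Nat.cast_ofNat]
    calc W x * ∑ μ, Cur μ x * n x μ ≤ W x * (4 * (CJ * p2 x)) :=
          mul_le_mul_of_nonneg_left (h1.trans h2.le) (hW0 x)
      _ = 4 * CJ * (W x * p2 x) := by ring
  -- ### the divergence of the weighted current at the points of `K`
  have hdiv : ∀ x ∈ K, F (E4.spatial x) ≤ x 0 → x 0 ≤ s + F (E4.spatial x) →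
      ∑ μ, fderiv ℝ (J μ) x (E4.basisVector μ) ≤ -ℓ x + e x := by
    intro x hxK _ _
    have hxU : x ∈ U := hKU hxK
    have hxr : rPlus M a < radius a x := hKr x hxK
    have hxpos : 0 < radius a x := hUpos x hxU
    -- differentiability
    have hWd : DifferentiableAt ℝ W x := (hW1.differentiable one_ne_zero) x
    have hχd : DifferentiableAt ℝ χ x := (hχ1.differentiable one_ne_zero) x
    have hhfd : DifferentiableAt ℝ hf x := (hhf1.differentiable one_ne_zero) x
    have hJNd : ∀ μ, DifferentiableAt ℝ (JN μ) x := fun μ ↦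
      (hJN1 μ x hxU).differentiableAt one_ne_zero
    have hPd : ∀ μ, DifferentiableAt ℝ (P μ) x := fun μ ↦
      (hP1 μ x hxU).differentiableAt one_ne_zero
    have hCurd : ∀ μ, DifferentiableAt ℝ (Cur μ) x := fun μ ↦
      (hCur1 μ x hxU).differentiableAt one_ne_zero
    -- product rules
    have hdW : ∀ κ, fderiv ℝ W x (E4.basisVector κ) =
        fderiv ℝ χ x (E4.basisVector κ) * hf x + χ x * fderiv ℝ hf x (E4.basisVector κ) := by
      intro κ
      have : W = fun y ↦ χ y * hf y := rfl
      rw [this, fderiv_fun_mul hχd hhfd]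
      simp only [add_apply, FunLike.coe_smul, Pi.smul_apply, smul_eq_mul]
      ring
    have hdJ : ∀ μ κ, fderiv ℝ (J μ) x (E4.basisVector κ) =
        fderiv ℝ W x (E4.basisVector κ) * Cur μ x + W x * fderiv ℝ (Cur μ) x (E4.basisVector κ) := by
      intro μ κ
      have : J μ = fun y ↦ W y * Cur μ y := rfl
      rw [this, fderiv_fun_mul hWd (hCurd μ)]
      simp only [add_apply, FunLike.coe_smul, Pi.smul_apply, smul_eq_mul]
      ring
    have hdCur : ∀ μ κ, fderiv ℝ (Cur μ) x (E4.basisVector κ) =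
        -fderiv ℝ (JN μ) x (E4.basisVector κ) + ε₀ * fderiv ℝ (P μ) x (E4.basisVector κ) := by
      intro μ κ
      have h1 : DifferentiableAt ℝ (fun y ↦ -JN μ y) x := (hJNd μ).neg
      have h2 : DifferentiableAt ℝ (fun y ↦ ε₀ * P μ y) x := (hPd μ).const_mul ε₀
      have : Cur μ = fun y ↦ -JN μ y + ε₀ * P μ y := rfl
      rw [this, fderiv_fun_add h1 h2, fderiv_fun_neg, fderiv_const_mul (hPd μ)]
      simp only [add_apply, neg_apply, FunLike.coe_smul, Pi.smul_apply, smul_eq_mul]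
    -- the divergences of `J^N` and `J^{dt*}`
    have hdivN : ∑ μ, fderiv ℝ (JN μ) x (E4.basisVector μ) =
        KerrSchild.multiplierBulk (inverseMetric M a) N Φ x :=
      sum_fderiv_redShiftCurrent hMa hp hp (hΦ x hxU) hxr (hsol x hxU)
    have hdivP : ∑ μ, fderiv ℝ (P μ) x (E4.basisVector μ) = KerrSchild.deformationTerm G Φ x := by
      have h := KerrSchild.sum_fderiv_normalCurrent (B.differentiableAt_inverseMetric x)
        (B.inverseMetric_symm x) (hΦ x hxU)
      rw [hsol x hxU, zero_mul, zero_add] at h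
      exact h
    -- assemble the divergence, term by term
    have hterm : ∀ μ, fderiv ℝ (J μ) x (E4.basisVector μ) =
        hf x * (fderiv ℝ χ x (E4.basisVector μ) * Cur μ x) +
          χ x * (-(fderiv ℝ hf x (E4.basisVector μ) * JN μ x) +
            ε₀ * (fderiv ℝ hf x (E4.basisVector μ) * P μ x)) +
          W x * (-fderiv ℝ (JN μ) x (E4.basisVector μ) +
            ε₀ * fderiv ℝ (P μ) x (E4.basisVector μ)) := by
      intro μ
      rw [hdJ, hdW, hdCur, hWdef]
      simp only [hCur]
      ring
    have hS2 : ∑ μ, (-(fderiv ℝ hf x (E4.basisVector μ) * JN μ x) +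
        ε₀ * (fderiv ℝ hf x (E4.basisVector μ) * P μ x)) =
        -(∑ μ, fderiv ℝ hf x (E4.basisVector μ) * JN μ x) +
          ε₀ * ∑ μ, fderiv ℝ hf x (E4.basisVector μ) * P μ x := by
      rw [Finset.sum_add_distrib, Finset.sum_neg_distrib, ← Finset.mul_sum]
    have hS3 : ∑ μ, (-fderiv ℝ (JN μ) x (E4.basisVector μ) +
        ε₀ * fderiv ℝ (P μ) x (E4.basisVector μ)) =
        -KerrSchild.multiplierBulk (inverseMetric M a) N Φ x +
          ε₀ * KerrSchild.deformationTerm G Φ x := by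
      rw [Finset.sum_add_distrib, Finset.sum_neg_distrib, ← Finset.mul_sum, hdivN, hdivP]
    have hsum : ∑ μ, fderiv ℝ (J μ) x (E4.basisVector μ) =
        hf x * ∑ μ, fderiv ℝ χ x (E4.basisVector μ) * Cur μ x +
          χ x * (-(∑ μ, fderiv ℝ hf x (E4.basisVector μ) * JN μ x) +
            ε₀ * ∑ μ, fderiv ℝ hf x (E4.basisVector μ) * P μ x) +
          W x * (-KerrSchild.multiplierBulk (inverseMetric M a) N Φ x +
            ε₀ * KerrSchild.deformationTerm G Φ x) := by
      rw [Finset.sum_congr rfl fun μ _ ↦ hterm μ, Finset.sum_add_distrib, Finset.sum_add_distrib,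
        ← Finset.mul_sum, ← Finset.mul_sum, ← Finset.mul_sum, hS2, hS3]
    rw [hsum]
    -- (i) the inner-boundary fluxes have signs
    obtain ⟨hNN, hN0, -⟩ := hcolK x hxK
    have hβ : 0 < 1 + hp * (radius a x - rPlus M a) := by
      have : 0 ≤ hp * (radius a x - rPlus M a) := mul_nonneg hp0.le (by linarith)
      linarith
    have hi1 : 0 ≤ ∑ μ, fderiv ℝ hf x (E4.basisVector μ) * JN μ x :=
      redShift_horizonFactor_flux hMa Φ hε hxr hNN hN0 hβ
    have hi2 : ∑ μ, fderiv ℝ hf x (E4.basisVector μ) * P μ x ≤ 0 :=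
      horizonFactor_flux hMa Φ hε hxr
    have hi : χ x * (-(∑ μ, fderiv ℝ hf x (E4.basisVector μ) * JN μ x) +
        ε₀ * ∑ μ, fderiv ℝ hf x (E4.basisVector μ) * P μ x) ≤ 0 := by
      refine mul_nonpos_iff.mpr (Or.inl ⟨hχ0 x, ?_⟩)
      have := mul_nonpos_iff.mpr (Or.inl ⟨hε₀pos.le, hi2⟩)
      linarith
    -- (ii) the cut-off error
    have hii : hf x * ∑ μ, fderiv ℝ χ x (E4.basisVector μ) * Cur μ x ≤ e x := by
      have h1 : |∑ μ, fderiv ℝ χ x (E4.basisVector μ) * Cur μ x| ≤ CJ * (V x * p2 x) := by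
        calc |∑ μ, fderiv ℝ χ x (E4.basisVector μ) * Cur μ x|
            ≤ ∑ μ, |fderiv ℝ χ x (E4.basisVector μ) * Cur μ x| := Finset.abs_sum_le_sum_abs _ _
          _ ≤ ∑ μ, |fderiv ℝ χ x (E4.basisVector μ)| * (CJ * p2 x) := by
              refine Finset.sum_le_sum fun μ _ ↦ ?_
              rw [abs_mul]
              exact mul_le_mul_of_nonneg_left (hCurK x hxK μ) (abs_nonneg _)
          _ = CJ * (V x * p2 x) := by rw [hV, ← Finset.sum_mul]; ring
      have h2 : hf x * ∑ μ, fderiv ℝ χ x (E4.basisVector μ) * Cur μ x ≤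
          |∑ μ, fderiv ℝ χ x (E4.basisVector μ) * Cur μ x| :=
        (mul_le_mul_of_nonneg_left (le_abs_self _) (hhf0 x)).trans
          (mul_le_of_le_one_left (abs_nonneg _) (hhfle x))
      have h3 : CJ * (V x * p2 x) ≤ e x := by
        have h0 : 0 ≤ CJ * (V x * p2 x) := mul_nonneg hCJ0 (mul_nonneg (hV0 x) (hp2nn x))
        show CJ * (V x * p2 x) ≤ 4 * CJ * (V x * p2 x)
        linarith only [h0]
      exact h2.trans (h1.trans h3)
    -- (iii) the bulk: coercivity of `K^N` and smallness of `ε₀ R`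
    have hiii : W x * (-KerrSchild.multiplierBulk (inverseMetric M a) N Φ x +
        ε₀ * KerrSchild.deformationTerm G Φ x) ≤ -ℓ x := by
      have h1 : b₁ * p2 x ≤ KerrSchild.multiplierBulk (inverseMetric M a) N Φ x :=
        hcoer x (hKr x hxK).le (hKR₂ x hxK) Φ
      have h2 : |KerrSchild.deformationTerm G Φ x| ≤ 32 * (1 + B.bound) * D * p2 x :=
        B.abs_deformationTerm_le Φ x hD0 (fun μ α β ↦ hD x μ α β)
      have h3 : ε₀ * KerrSchild.deformationTerm G Φ x ≤ b₁ / 2 * p2 x := by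
        calc ε₀ * KerrSchild.deformationTerm G Φ x ≤ ε₀ * (32 * (1 + B.bound) * D * p2 x) :=
              mul_le_mul_of_nonneg_left ((le_abs_self _).trans h2) hε₀pos.le
          _ = ε₀ * (32 * (1 + B.bound) * D) * p2 x := by ring
          _ ≤ b₁ / 2 * p2 x := mul_le_mul_of_nonneg_right hε₀D (hp2nn x)
      have h4 : -KerrSchild.multiplierBulk (inverseMetric M a) N Φ x +
          ε₀ * KerrSchild.deformationTerm G Φ x ≤ -(b₁ / 2 * p2 x) := by linarith
      calc W x * (-KerrSchild.multiplierBulk (inverseMetric M a) N Φ x +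
            ε₀ * KerrSchild.deformationTerm G Φ x) ≤ W x * (-(b₁ / 2 * p2 x)) :=
            mul_le_mul_of_nonneg_left h4 (hW0 x)
        _ = -ℓ x := by simp only [hℓ]; ring
    linarith only [hi, hii, hiii]
  -- ### the energy inequality along the graph foliation
  have hmain := E4.graphFlux_add_integral_le_of_divergence_le hKc hJ1 hJ0 hF hρK hℓc hec hℓK he0
    hdiv hs le_rfl
  -- ### comparison of the four integrals
  have hgraph : ∀ t : ℝ, Continuous fun y : E3 ↦ E4.ofTimeSpace (t + F y) y := fun t ↦
    E4.continuous_ofTimeSpace' (continuous_const.add hF.continuous) continuous_id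
  have hF1 : ContDiff ℝ 1 F := hF.of_le one_le_two
  have hnc : ∀ μ, Continuous fun y : E3 ↦ graphConormal F y μ := by
    intro μ
    refine Fin.cases ?_ (fun i ↦ ?_) μ
    · simp only [graphConormal_zero]; exact continuous_const
    · simp only [graphConormal_succ, partialE3]
      exact ((hF1.continuous_fderiv one_ne_zero).clm_apply continuous_const).neg
  -- the weighted density `W ∑(∂Φ)²` is continuous on `ℝ⁴`
  have hWp2c : Continuous fun x ↦ W x * p2 x :=
    continuous_iff_continuousAt.mpr fun x ↦ continuousAt_weight_mul hKc hKU hW1.continuous hWz hp2c x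
  have hVp2c : Continuous fun x ↦ V x * p2 x :=
    continuous_iff_continuousAt.mpr fun x ↦ continuousAt_weight_mul hKshc hKshU hVc hVz hp2c x
  have hfluxc : ∀ t, Continuous fun y : E3 ↦
      ∑ μ, J μ (E4.ofTimeSpace (t + F y) y) * graphConormal F y μ := fun t ↦
    continuous_finsetSum _ fun μ _ ↦ ((hJ1 μ).continuous.comp (hgraph t)).mul (hnc μ)
  have hint : ∀ (g : E4 → ℝ), Continuous g → ∀ t,
      IntegrableOn (fun y : E3 ↦ g (E4.ofTimeSpace (t + F y) y)) (closedBall (0 : E3) ρ) :=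
    fun g hg t ↦ (hg.comp (hgraph t)).continuousOn.integrableOn_compact (isCompact_closedBall _ _)
  -- (a) the flux at time `s` from below
  have ha : A * c * (∫ y in closedBall (0 : E3) ρ, W (E4.ofTimeSpace (s + F y) y) *
      p2 (E4.ofTimeSpace (s + F y) y)) ≤
      ∫ y in closedBall (0 : E3) ρ, ∑ μ, J μ (E4.ofTimeSpace (s + F y) y) * graphConormal F y μ := by
    rw [← integral_const_mul]
    refine setIntegral_mono_on ((hint _ hWp2c s).const_mul _)
      ((hfluxc s).continuousOn.integrableOn_compact (isCompact_closedBall _ _))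
      measurableSet_closedBall fun y _ ↦ ?_
    have h := hqlow (E4.ofTimeSpace (s + F y) y)
    simp only [hn, E4.spatial_ofTimeSpace] at h
    exact h
  -- (b) the flux at time `0` from above
  have hb : (∫ y in closedBall (0 : E3) ρ, ∑ μ, J μ (E4.ofTimeSpace (0 + F y) y) *
      graphConormal F y μ) ≤ 4 * CJ * ∫ y in closedBall (0 : E3) ρ,
        W (E4.ofTimeSpace (0 + F y) y) * p2 (E4.ofTimeSpace (0 + F y) y) := by
    rw [← integral_const_mul]
    refine setIntegral_mono_on
      ((hfluxc 0).continuousOn.integrableOn_compact (isCompact_closedBall _ _))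
      ((hint _ hWp2c 0).const_mul _) measurableSet_closedBall fun y _ ↦ ?_
    have h := hqup (E4.ofTimeSpace (0 + F y) y)
    simp only [hn, E4.spatial_ofTimeSpace] at h
    exact h
  -- (c) the bulk integrals
  have hcℓ : (∫ u in Set.Ioc 0 s, ∫ y in closedBall (0 : E3) ρ, ℓ (E4.ofTimeSpace (u + F y) y)) =
      b₁ / 2 * ∫ u in Set.Ioc 0 s, ∫ y in closedBall (0 : E3) ρ,
        W (E4.ofTimeSpace (u + F y) y) * p2 (E4.ofTimeSpace (u + F y) y) := by
    simp only [hℓ, integral_const_mul]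
  have hce : (∫ u in Set.Ioc 0 s, ∫ y in closedBall (0 : E3) ρ, e (E4.ofTimeSpace (u + F y) y)) =
      4 * CJ * ∫ u in Set.Ioc 0 s, ∫ y in closedBall (0 : E3) ρ,
        V (E4.ofTimeSpace (u + F y) y) * p2 (E4.ofTimeSpace (u + F y) y) := by
    simp only [he, integral_const_mul]
  have hYnn : 0 ≤ ∫ u in Set.Ioc 0 s, ∫ y in closedBall (0 : E3) ρ,
      W (E4.ofTimeSpace (u + F y) y) * p2 (E4.ofTimeSpace (u + F y) y) :=
    setIntegral_nonneg measurableSet_Ioc fun u _ ↦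
      setIntegral_nonneg measurableSet_closedBall fun y _ ↦ mul_nonneg (hW0 _) (hp2nn _)
  have hcA : A * (∫ u in Set.Ioc 0 s, ∫ y in closedBall (0 : E3) ρ,
      W (E4.ofTimeSpace (u + F y) y) * p2 (E4.ofTimeSpace (u + F y) y)) ≤
      ∫ u in Set.Ioc 0 s, ∫ y in closedBall (0 : E3) ρ, ℓ (E4.ofTimeSpace (u + F y) y) := by
    rw [hcℓ]
    exact mul_le_mul_of_nonneg_right hAb hYnn
  -- ### conclusion
  have hfin := add_le_add ha hcA
  have hfin' := add_le_add_right hb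
    (∫ u in Set.Ioc 0 s, ∫ y in closedBall (0 : E3) ρ, e (E4.ofTimeSpace (u + F y) y))
  rw [hce] at hfin' hmain
  simp only [hp2] at hfin hfin' hmain ⊢
  linarith

end Kerr

end Literature.Geometry.Lorentzian

end
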